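import Literature.AnabelianGeometry.AbsoluteAnabelian.CyclotomicSynchronizationCor110iaProofs
import Literature.AnabelianGeometry.AbsoluteAnabelian.GaloisCyclotomeRestrictionIndex
import HarnessLib

/-!
# [AbsTopIII] Rmk. 1.10.1 (iii) AT Cor. 1.10 (i)(a): restriction is multiplication by the index

S. Mochizuki, *Topics in Absolute Anabelian Geometry III* (2015), Cor. 1.10 (i) p. 41–42: «a functorial
"group-theoretic" algorithm for reconstructing the natural isomorphism `H²(G_k, μ_Ẑ(G_k)) ⥲ Ẑ` … Here,
the asserted "functoriality" is with respect to arbitrary injective open homomorphisms of profinite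
groups [cf. also Remark 1.10.1, (iii), below]», and Rmk. 1.10.1 (iii) p. 44: this functoriality «is to be
understood in the sense of a compatibility relative to dividing the `Ẑ` … by a factor given by the index
of the image of the induced open homomorphism», i.e. the isomorphisms for `G_k` and for an open subgroup
are «compatible with the result of dividing the usual functorially induced morphism by a factor given by
the index».  abc-iut cell, layer L4 (L4-lead RULING #6c «GO (O4)», part 3 — the part that waited for the
olean of abc-iut-L4-t17's `CyclotomicSynchronizationCor110iaProofs`; seat abc-iut-w5-d201).

THE TREE'S NATURAL ISOMORPHISM of Cor. 1.10 (i)(a) (abc-iut-L4-t17, `AbsTopIII.Cor_1_10_i_a_holds`): for a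
`p`-adic local field `k` and a `G_k`-equivariant identification `φ : μ_{ℚ/ℤ}(G_k) ≅ μ(k̄)` ([AbsAnab]
Prop. 1.2.1 (vi), F-0018, PROVED), `H²(G_k, μ_Ẑ(G_k)) ⥲ lim_i H²(G_k, μ_{(i+1)!})`
(`DiscreteTowerPresentation.limitClassesEquiv` along `galCyclotomeTower φ hφ`, NSW (2.7.6)) `⥲ lim_i ℤ/(i+1)!`
(`limitClassesEquivZModChain`, the levelwise residue maps `Prop121vii.invLevel` = [AbsAnab] Prop. 1.2.1
(vii)) — canonical up to this point — followed by some `lim_i ℤ/(i+1)! ≃+ Ẑ` (`zmodChain` is free procyclic).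

THIS FILE (proofs only, no new definition, no named fact), for a finite extension `k′/k` of `p`-adic local
fields (characteristic `0`; each field with its own local structure), the «usual functorially induced
morphism» `Res = galCyclotomeRes k k′ 2 : H²(G_k, μ_Ẑ(G_k)) → H²(G_{k′}, μ_Ẑ(G_{k′}))` (abc-iut-w5-d201,
`GaloisCyclotomeRestriction.lean`) and the identification `φ′ := inducedCyclotomeEquiv k k′ φ` of
`μ_{ℚ/ℤ}(G_{k′})` induced from `φ` (`GaloisCyclotomeRestrictionIndex.lean`):

* `limitClassesEquivZModChain_galCyclotomeRes` — **`ι_{k′}(Res x) = [k′ : k] · ι_k(x)` in `lim_i ℤ/(i+1)!`**,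
  `ι` the natural isomorphisms above: under the natural isomorphisms, `Res` IS multiplication by the
  index (print's «dividing by the index» makes the square commute); componentwise this is part 2's
  `invLevel_toLimitClasses_galCyclotomeRes` (Serre XIII §3 Prop. 7);
* `map_limitClassesEquivZModChain_galCyclotomeRes` — the same through ANY common additive identification of
  `lim_i ℤ/(i+1)!` (e.g. one `zmodChain ≃+ ZHatCoeff` used at `k` and at `k′`): the `Ẑ`-valued form;
* `zmodChain_eq_zero_of_nsmul_eq_zero` — `lim_i ℤ/(i+1)!` is torsion-free; hence
  `galCyclotomeRes_two_injective` — **`Res : H²(G_k, μ_Ẑ(G_k)) → H²(G_{k′}, μ_Ẑ(G_{k′}))` is injective**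
  (for every MLF `k` and every finite `k′/k`), and `galCyclotomeRes_two_surjective_iff` — it is
  surjective iff `[k′ : k] = 1` (`zmodChain_nsmul_ne_one`: `𝟙 ∈ lim_i ℤ/(i+1)!` is not divisible by any
  `d > 1`).

SCOPE (honest, as in part 2): the identification of `μ_{ℚ/ℤ}(G_{k′})` is the one INDUCED from `φ` (the
restriction-compatible member of the family); agreement with an identification furnished independently
for `k′` is the naturality of local reciprocity under restriction (row «F0018-RES-NATURALITY», another
seat) and is not asserted.  Print speaks of arbitrary open injections `H ↪ G_k`; in the tree's transport
shape these are the `absGaloisRestrict k k′` up to isomorphism (`LocalResidueMapOpenSubgroup.lean`,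
abc-iut-w4-d045: an open `U ≤ G_k` is `G_{k_U}` with `[k_U : k] = [G_k : U]`).  Classical local class
field theory and profinite bookkeeping; nothing here bears on [IUTchIII] Cor. 3.12 or takes a side.

## References
* [MochizukiAbsTopIII2015] S. Mochizuki, *Topics in Absolute Anabelian Geometry III*, Cor. 1.10 (i)
  p. 41–42, Rmk. 1.10.1 (iii) p. 44.
* [NeukirchSchmidtWingberg2008] J. Neukirch, A. Schmidt, K. Wingberg, *Cohomology of Number Fields*,
  (7.1.4), Cor. (2.7.6).
* [SerreLocalFields1979] J.-P. Serre, *Local Fields*, Ch. XIII §3 Prop. 7.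
-/

noncomputable section

open CategoryTheory Function

universe u

namespace Literature.AnabelianGeometry.AbsoluteAnabelian

open Field
open Literature.NumberTheory.GaloisRepresentations
open Literature.NumberTheory.GaloisRepresentations.DiscreteGaloisModule

/-! ### `lim_i ℤ/(i+1)!` is torsion-free -/

section ZModChain

/-- Components of `d • x` in `lim_i ℤ/(i+1)!`: `(d • x)_i = d · x_i`. [cite: RibesZalesskii2010, Thm 2.7.1] -/
theorem zmodChain_coe_nsmul_apply (d : ℕ) (x : zmodChain) (i : ℕ) :
    (d • x : zmodChain).1 i = (d : ZMod ((cycLevel i : ℕ+) : ℕ)) * x.1 i := by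
  change (d • (x.1 : ∀ j, ZMod ((cycLevel j : ℕ+) : ℕ))) i = _
  rw [Pi.smul_apply, nsmul_eq_mul]

/-- For every `i` and every `d ≥ 1` there is a level `j ≥ i` of the factorial chain with
`(i+1)! · d ∣ (j+1)!`. [cite: RibesZalesskii2010, Thm 2.7.1] -/
theorem exists_level_mul_dvd_cycLevel (i : ℕ) {d : ℕ} (hd : d ≠ 0) :
    ∃ j, i ≤ j ∧ ((cycLevel i : ℕ+) : ℕ) * d ∣ ((cycLevel j : ℕ+) : ℕ) := by
  set N : ℕ+ := cycLevel i * ⟨d, Nat.pos_of_ne_zero hd⟩ with hN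
  refine ⟨N.natPred, ?_, ?_⟩
  · have h1 : i + 1 ≤ (N : ℕ) := by
      rw [hN, PNat.mul_coe, PNat.mk_coe, coe_cycLevel]
      exact (Nat.self_le_factorial (i + 1)).trans (Nat.le_mul_of_pos_right _ (Nat.pos_of_ne_zero hd))
    have h2 := PNat.natPred_add_one N
    omega
  · have h := dvd_cycLevel_natPred N
    rwa [hN, PNat.mul_coe, PNat.mk_coe] at h

/-- **`lim_i ℤ/(i+1)!` is torsion-free**: `d • x = 0` with `d ≠ 0` forces `x = 0` (each component `x_i`
is the reduction of a component `x_j` at a level `(j+1)!` divisible by `(i+1)! · d`, and `d · x_j = 0`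
there forces `(i+1)! ∣ x_j`).  (`lim_i ℤ/(i+1)! ≅ Ẑ = ∏_p ℤ_p`, a torsion-free group.)
[cite: RibesZalesskii2010, Thm 2.7.1] -/
theorem zmodChain_eq_zero_of_nsmul_eq_zero {d : ℕ} (hd : d ≠ 0) {x : zmodChain} (h : d • x = 0) :
    x = 0 := by
  refine Subtype.ext (funext fun i => ?_)
  obtain ⟨j, hij, hdvd⟩ := exists_level_mul_dvd_cycLevel i hd
  -- at level `j`: `d · x_j = 0`, i.e. `(j+1)! ∣ d · val(x_j)`
  have hj : (d : ZMod ((cycLevel j : ℕ+) : ℕ)) * x.1 j = 0 := by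
    rw [← zmodChain_coe_nsmul_apply, h]; rfl
  have hj' : ((cycLevel j : ℕ+) : ℕ) ∣ d * (x.1 j).val := by
    rw [← ZMod.natCast_eq_zero_iff, Nat.cast_mul, ZMod.natCast_zmod_val]
    exact hj
  -- hence `(i+1)! ∣ val(x_j)` and `x_i = val(x_j) mod (i+1)! = 0`
  have hi : ((cycLevel i : ℕ+) : ℕ) ∣ (x.1 j).val := by
    have h2 : ((cycLevel i : ℕ+) : ℕ) * d ∣ d * (x.1 j).val := hdvd.trans hj'
    rw [mul_comm] at h2
    exact Nat.dvd_of_mul_dvd_mul_left (Nat.pos_of_ne_zero hd) h2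
  rw [← natCast_val_apply_of_le x hij, (ZMod.natCast_eq_zero_iff _ _).2 hi]
  rfl

/-- Multiplication by a non-zero natural number on `lim_i ℤ/(i+1)!` is injective.
[cite: RibesZalesskii2010, Thm 2.7.1] -/
theorem zmodChain_nsmul_right_injective {d : ℕ} (hd : d ≠ 0) :
    Injective fun x : zmodChain => d • x := by
  intro x y hxy
  have h : d • (x - y) = 0 := by
    change d • x = d • y at hxy
    rw [nsmul_sub, hxy, sub_self]
  exact sub_eq_zero.1 (zmodChain_eq_zero_of_nsmul_eq_zero hd h)

/-- `𝟙 = (1, 1, …) ∈ lim_i ℤ/(i+1)!` is not divisible by any `d > 1`: `d · y = 𝟙` would give `d · y_{d-1} = 1`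
in `ℤ/d!`, hence `0 = 1` in `ℤ/d`. [cite: RibesZalesskii2010, Thm 2.7.1] -/
theorem zmodChain_nsmul_ne_one {d : ℕ} (hd : 1 < d) (y : zmodChain) : d • y ≠ zmodChainOne := by
  intro h
  set D : ℕ+ := ⟨d, by omega⟩ with hD
  have hlev : (d : ZMod ((cycLevel D.natPred : ℕ+) : ℕ)) * y.1 D.natPred = 1 := by
    rw [← zmodChain_coe_nsmul_apply, h]; rfl
  have hdvd : d ∣ ((cycLevel D.natPred : ℕ+) : ℕ) := dvd_cycLevel_natPred D
  have h2 := congrArg (ZMod.castHom hdvd (ZMod d)) hlev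
  rw [map_mul, map_natCast, map_one, ZMod.natCast_self, zero_mul] at h2
  haveI : Fact (1 < d) := ⟨hd⟩
  exact zero_ne_one h2

end ZModChain

/-! ### Rmk. 1.10.1 (iii) for the natural isomorphism of Cor. 1.10 (i)(a) -/

section Index

variable (k k' : Type u) [Field k] [ValuativeRel k] [TopologicalSpace k] [IsNonarchimedeanLocalField k]
  [CharZero k] [Field k'] [ValuativeRel k'] [TopologicalSpace k'] [IsNonarchimedeanLocalField k']
  [CharZero k'] [Algebra k k'] [FiniteDimensional k k']
  (φ : muQZ (absoluteGaloisGroup k) ≃+ Additive (CommGroup.torsion (AlgebraicClosure k)ˣ))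
  (hφ : ∀ (σ : absoluteGaloisGroup k) (x : muQZ (absoluteGaloisGroup k)),
    (((Additive.toMul (φ (σ • x)) : CommGroup.torsion (AlgebraicClosure k)ˣ) :
        (AlgebraicClosure k)ˣ) : AlgebraicClosure k) =
      σ • (((Additive.toMul (φ x) : CommGroup.torsion (AlgebraicClosure k)ˣ) :
        (AlgebraicClosure k)ˣ) : AlgebraicClosure k))

/-- **[AbsTopIII] Rmk. 1.10.1 (iii) AT THE NATURAL ISOMORPHISM of Cor. 1.10 (i)(a)**: writing
`ι_k : H²(G_k, μ_Ẑ(G_k)) ⥲ lim_i H²(G_k, μ_{(i+1)!}) ⥲ lim_i ℤ/(i+1)!` for abc-iut-L4-t17's natural isomorphism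
(`limitClassesEquiv` then `limitClassesEquivZModChain`, at `φ` for `k` and at the induced identification
`inducedCyclotomeEquiv k k′ φ` for `k′`), the «usual functorially induced morphism»
`Res : H²(G_k, μ_Ẑ(G_k)) → H²(G_{k′}, μ_Ẑ(G_{k′}))` satisfies **`ι_{k′}(Res x) = [k′ : k] · ι_k(x)`** — i.e. the
isomorphisms with `Ẑ` are «compatible with the result of dividing the usual functorially induced morphism
by a factor given by the index». [cite: MochizukiAbsTopIII2015, Remark 1.10.1 p.44] -/
theorem limitClassesEquivZModChain_galCyclotomeRes (x : galCyclotomeH2 (absoluteGaloisGroup k)) :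
    limitClassesEquivZModChain k' (inducedCyclotomeEquiv k k' φ) (inducedCyclotomeEquiv_smul k k' φ hφ)
        (((galCyclotomeTower (inducedCyclotomeEquiv k k' φ) (inducedCyclotomeEquiv_smul k k' φ hφ)).limitClassesEquiv
          (finite_H1_galCyclotomeTower k' (inducedCyclotomeEquiv k k' φ) (inducedCyclotomeEquiv_smul k k' φ hφ)))
          ((galCyclotomeRes k k' 2).hom x)) =
      Module.finrank k k' •
        limitClassesEquivZModChain k φ hφ
          (((galCyclotomeTower φ hφ).limitClassesEquiv (finite_H1_galCyclotomeTower k φ hφ)) x) := by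
  refine Subtype.ext (funext fun i => ?_)
  rw [zmodChain_coe_nsmul_apply]
  change (limitClassesToZModChain k' _ _ _).1 i =
    (Module.finrank k k' : ZMod ((cycLevel i : ℕ+) : ℕ)) * (limitClassesToZModChain k φ hφ _).1 i
  rw [limitClassesToZModChain_apply_coe, limitClassesToZModChain_apply_coe,
    DiscreteTowerPresentation.limitClassesEquiv_apply_coe, DiscreteTowerPresentation.limitClassesEquiv_apply_coe]
  have h := invLevel_toLimitClasses_galCyclotomeRes k k' φ hφ i x
  rw [DiscreteTowerPresentation.toLimitClasses_apply_coe, DiscreteTowerPresentation.toLimitClasses_apply_coe] at h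
  exact h

/-- **The `Ẑ`-valued form**: through ANY common additive identification `e` of `lim_i ℤ/(i+1)!` (for
instance one `zmodChain ≃+ ZHatCoeff`, used at `k` and at `k′`), `e(ι_{k′}(Res x)) = [k′ : k] · e(ι_k(x))`.
[cite: MochizukiAbsTopIII2015, Remark 1.10.1 p.44] -/
theorem map_limitClassesEquivZModChain_galCyclotomeRes {A : Type*} [AddCommMonoid A] {F : Type*}
    [FunLike F zmodChain A] [AddMonoidHomClass F zmodChain A] (e : F)
    (x : galCyclotomeH2 (absoluteGaloisGroup k)) :
    e (limitClassesEquivZModChain k' (inducedCyclotomeEquiv k k' φ) (inducedCyclotomeEquiv_smul k k' φ hφ)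
        (((galCyclotomeTower (inducedCyclotomeEquiv k k' φ) (inducedCyclotomeEquiv_smul k k' φ hφ)).limitClassesEquiv
          (finite_H1_galCyclotomeTower k' (inducedCyclotomeEquiv k k' φ) (inducedCyclotomeEquiv_smul k k' φ hφ)))
          ((galCyclotomeRes k k' 2).hom x))) =
      Module.finrank k k' •
        e (limitClassesEquivZModChain k φ hφ
          (((galCyclotomeTower φ hφ).limitClassesEquiv (finite_H1_galCyclotomeTower k φ hφ)) x)) := by
  rw [limitClassesEquivZModChain_galCyclotomeRes, map_nsmul]

include φ hφ in
/-- `Res` on `H²(·, μ_Ẑ(·))` is injective, local-structure form (both fields carrying local structures and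
`φ` given): `ι_{k′} ∘ Res = [k′ : k] · ι_k` with `ι` bijective and `lim_i ℤ/(i+1)!` torsion-free.
[cite: MochizukiAbsTopIII2015, Remark 1.10.1 p.44] -/
theorem galCyclotomeRes_two_injective_of_equivariant : Injective (galCyclotomeRes k k' 2).hom := by
  intro x y hxy
  have hx := limitClassesEquivZModChain_galCyclotomeRes k k' φ hφ x
  have hy := limitClassesEquivZModChain_galCyclotomeRes k k' φ hφ y
  rw [hxy] at hx
  exact (AddEquiv.injective _) ((AddEquiv.injective _)
    (zmodChain_nsmul_right_injective (Module.finrank_pos (R := k) (M := k')).ne' (hx.symm.trans hy)))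

include φ hφ in
/-- `Res` on `H²(·, μ_Ẑ(·))` is surjective iff `[k′ : k] = 1`, local-structure form: under the natural
isomorphisms `Res` is multiplication by `[k′ : k]` on `lim_i ℤ/(i+1)! ∋ 𝟙`.
[cite: MochizukiAbsTopIII2015, Remark 1.10.1 p.44] -/
theorem galCyclotomeRes_two_surjective_iff_of_equivariant :
    Surjective (galCyclotomeRes k k' 2).hom ↔ Module.finrank k k' = 1 := by
  set ι' := ((galCyclotomeTower (inducedCyclotomeEquiv k k' φ) (inducedCyclotomeEquiv_smul k k' φ hφ)).limitClassesEquiv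
      (finite_H1_galCyclotomeTower k' (inducedCyclotomeEquiv k k' φ) (inducedCyclotomeEquiv_smul k k' φ hφ))).trans
    (limitClassesEquivZModChain k' (inducedCyclotomeEquiv k k' φ) (inducedCyclotomeEquiv_smul k k' φ hφ)) with hι'
  set ι := ((galCyclotomeTower φ hφ).limitClassesEquiv (finite_H1_galCyclotomeTower k φ hφ)).trans
    (limitClassesEquivZModChain k φ hφ) with hι
  have key : ∀ x, ι' ((galCyclotomeRes k k' 2).hom x) = Module.finrank k k' • ι x := fun x =>
    limitClassesEquivZModChain_galCyclotomeRes k k' φ hφ x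
  constructor
  · intro hsurj
    by_contra hne
    have hlt : 1 < Module.finrank k k' :=
      lt_of_le_of_ne (Module.finrank_pos (R := k) (M := k')) (Ne.symm hne)
    obtain ⟨x, hx⟩ := hsurj (ι'.symm zmodChainOne)
    have h1 : ι' ((galCyclotomeRes k k' 2).hom x) = zmodChainOne := by rw [hx, AddEquiv.apply_symm_apply]
    rw [key] at h1
    exact zmodChain_nsmul_ne_one hlt _ h1
  · intro h1 z
    refine ⟨ι.symm (ι' z), ι'.injective ?_⟩
    rw [key, h1, one_smul, AddEquiv.apply_symm_apply]

end Index

/-! ### Hypothesis-minimal forms: `k` an MLF, `k′/k` finite -/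

section MLF

variable (k k' : Type u) [Field k] [CharZero k] [Field k'] [CharZero k'] [Algebra k k'] [FiniteDimensional k k']

/-- **`Res : H²(G_k, μ_Ẑ(G_k)) → H²(G_{k′}, μ_Ẑ(G_{k′}))` is injective** for every MLF `k` and every finite
extension `k′/k` (of characteristic `0`): equip `k`, `k′` with their local structures as finite extensions
of `ℚ_p` (`FiniteExtension.*`), take `φ` from [AbsAnab] Prop. 1.2.1 (vi)
(`mlfGaloisCyclotomeIsRootsOfUnity_holds`), and apply `galCyclotomeRes_two_injective_of_equivariant`.
[cite: MochizukiAbsTopIII2015, Remark 1.10.1 p.44] -/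
theorem galCyclotomeRes_two_injective (hk : IsMLF k) : Injective (galCyclotomeRes k k' 2).hom := by
  obtain ⟨p, hp, f, hfin⟩ := hk.exists_padic
  letI : Algebra ℚ_[p] k := f.toAlgebra
  haveI : Module.Finite ℚ_[p] k := hfin
  letI : Algebra ℚ_[p] k' := ((algebraMap k k').comp f).toAlgebra
  haveI : IsScalarTower ℚ_[p] k k' := IsScalarTower.of_algebraMap_eq fun _ => rfl
  haveI : Module.Finite ℚ_[p] k' := Module.Finite.trans k k'
  haveI : IsNonarchimedeanLocalField ℚ_[p] := Padic.isNonarchimedeanLocalField_holds p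
  letI := FiniteExtension.normedField ℚ_[p] k
  letI := FiniteExtension.valuativeRel ℚ_[p] k
  haveI : IsNonarchimedeanLocalField k := FiniteExtension.isNonarchimedeanLocalField ℚ_[p] k
  letI := FiniteExtension.normedField ℚ_[p] k'
  letI := FiniteExtension.valuativeRel ℚ_[p] k'
  haveI : IsNonarchimedeanLocalField k' := FiniteExtension.isNonarchimedeanLocalField ℚ_[p] k'
  obtain ⟨φ, hφ⟩ := mlfGaloisCyclotomeIsRootsOfUnity_holds k hk
  exact galCyclotomeRes_two_injective_of_equivariant k k' φ hφ

/-- **`Res : H²(G_k, μ_Ẑ(G_k)) → H²(G_{k′}, μ_Ẑ(G_{k′}))` is surjective iff `[k′ : k] = 1`** (so it is an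
isomorphism iff `k′ = k`, and for a proper extension its image is the subgroup of index `[k′ : k]` of
`H²(G_{k′}, μ_Ẑ(G_{k′})) ≅ Ẑ`), for every MLF `k` and finite `k′/k`.
[cite: MochizukiAbsTopIII2015, Remark 1.10.1 p.44] -/
theorem galCyclotomeRes_two_surjective_iff (hk : IsMLF k) :
    Surjective (galCyclotomeRes k k' 2).hom ↔ Module.finrank k k' = 1 := by
  obtain ⟨p, hp, f, hfin⟩ := hk.exists_padic
  letI : Algebra ℚ_[p] k := f.toAlgebra
  haveI : Module.Finite ℚ_[p] k := hfin
  letI : Algebra ℚ_[p] k' := ((algebraMap k k').comp f).toAlgebra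
  haveI : IsScalarTower ℚ_[p] k k' := IsScalarTower.of_algebraMap_eq fun _ => rfl
  haveI : Module.Finite ℚ_[p] k' := Module.Finite.trans k k'
  haveI : IsNonarchimedeanLocalField ℚ_[p] := Padic.isNonarchimedeanLocalField_holds p
  letI := FiniteExtension.normedField ℚ_[p] k
  letI := FiniteExtension.valuativeRel ℚ_[p] k
  haveI : IsNonarchimedeanLocalField k := FiniteExtension.isNonarchimedeanLocalField ℚ_[p] k
  letI := FiniteExtension.normedField ℚ_[p] k'
  letI := FiniteExtension.valuativeRel ℚ_[p] k'
  haveI : IsNonarchimedeanLocalField k' := FiniteExtension.isNonarchimedeanLocalField ℚ_[p] k'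
  obtain ⟨φ, hφ⟩ := mlfGaloisCyclotomeIsRootsOfUnity_holds k hk
  exact galCyclotomeRes_two_surjective_iff_of_equivariant k k' φ hφ

end MLF

end Literature.AnabelianGeometry.AbsoluteAnabelian

end
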